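/-
Copyright (c) 2026 the pub-hodgecm-mathlib formalisation cell (harness21).  Prover seat hodgecm-mathlib-K2E3-p37 (g3): Track B «K2-LIT»,
hLiu418 = stmt-HodgeConjecture-24832; LEAD F0P6-plan (g14) BATCH #180 (1) «the GOOD-PLACE HALF of the K1 per-place producer» (line lead K2E5-p16 (g8) WORD #9 (2));
bad ∕ CM places = LH4-p07 (g11) `K2LiuKindOneSingularLocalFace`; consumer ★ p863286 `K2LiuKindOneSingularGlobalAssembler` (place letters BY VALUE).
-/
import Summits.HodgeConjecture.HodgeConjecture.Theorems.K2LiuRankOneSingularLocalValueCMRecord   -- ★ p863366 (K1a-2d) ED. 3 (K2E3-p37 (g3)): §1 dictionary, §2 per-place `hGK`, §3 cofinite letters (+ ★ (2d), ★ (A′))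
import Summits.HodgeConjecture.HodgeConjecture.Theorems.K2LiuQRationalLFactor                    -- ★ `IsQRationalRegularAt` algebra: `comp_affine`, `one_sub_mul_qVar_ne_zero`, `qVar_natCast_mul`
import HarnessLib

/-!
# Crux `HLiu418`, socket #41 KIND 1 a♮ ∕ U1-glob LEVEL 2 — THE GOOD-PLACE HALF OF THE K1 PER-PLACE PRODUCER: at cofinitely many places `v` the twisted local face
# `∫ conj ψ_{S♭}(ι_v y) · Λ_{s,v}((w_Δ)_v·y·h_v) dν(y)` IS the `q_v`-rational function `ν(N_Δ∩K_v) · c^{K1}_v(s) · Σ_{k ≤ ord_v τ} (ε_v q_v^{1−2s})^k`, regular on `{0 < re}`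

Cell `hodgecm-mathlib`, crux item hLiu418 = `stmt-HodgeConjecture-24832`, route `HCCMUnconditional`; squad K2 ∕ K2Liu; prover K2E3-p37 (g3) (BATCH #180 (1));
line lead K2E5-p16 (g8) (WORD #9 (2): «output row = ★ p863286's place-letter binders at good `v`: `W v :=` the ★ p863366∕★ p863217 value, `Gn v :=` its `q`-rational
continuation `c¹_v(s)·Σ_{k≤m_v}(ε_v q_v^{1−2s})^k`, `hGn` by ★ `IsQRationalRegularAt` algebra, `hW` on `{1 < re}` = ★ p863366's head»).  THEOREMS ONLY (no `def`, no
instance, no notation, no named-fact hypothesis, no `sorry`); lane `--supports stmt-HodgeConjecture-24832 --as helper` (count-neutral helper; closes no socket).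

THE ROW (★ p863286 `exists_headContinuation_of_placeLetters` ∕ `exists_Gc_of_placeLetters_scalarK1_cm`, per place `v` of the finite head set, BY VALUE):
`q v` (a residue cardinality, `≠ 0`), `W v s h` (the place's factor of ★ G1's Euler head — for a pure-tensor head section ★ p862937: `∫ conj ψ_{S♭}(ι_v y) · f_v s ((w_Δ)_v·y·h_v) dν_v(y)`),
`Gn v s h` with `hGn : ∀ s₀, 0 < re s₀ → IsQRationalRegularAt (q v) s₀ (Gn v · h)` and `hW : ∀ s, c₀ < re s → W v s h = Gn v s h`.  AT A GOOD PLACE the local section is the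
normalised spherical vector `Λ_{s,v}` (★ D7c `LambdaLoc`) and `h_v ∈ K_{H,v}`, so `W v s h` does not see `h` (right `K_v`-invariance, ★ (4c) `isSphericalSection_lambdaLoc`) and
★ p863366 evaluates it; this file supplies the two letters at every `v` off ONE finite set `T₀` (any Haar `ν` on `N_Δ(L⁺_v)`, normalised or not):
* §1 **`isQRationalRegularAt_localScalarK1_mul_twistedPoly`** — for `1 < q`, constants `C, ε`, `M : ℕ`, `0 < re s₀`:
  `s ↦ C · (1 − q^{−(2s+1)})(1 − ε q^{−(2s+2)})∕(1 − q^{−2s}) · Σ_{k≤M}(ε q^{1−2s})^k` is `q^{−s}`-rational and regular at `s₀` (a polynomial in `X = q^{−s}` over `1 − X²`, and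
  `‖X²‖ < 1` at `s₀`; ★ F1 `K2LiuQRationalDefs` algebra) — the `hGn` letter, in both bases `v.residueCard` and `residueFieldCard (L⁺_v)` (★ `residueFieldCard_adicCompletion_eq`);
* §2 **`exists_finset_forall_localFace_goodPlace_of_record`** — at the record `χ = toHeckeCharacter L lam⁻¹` (`lam` conjugate-symplectic), corner index `S♭ = single 1 1 σ`,
  `τ := t₁·Tr_{L∕L⁺}(σδ) ≠ 0`: `∃ T₀` finite with, for every `v ∉ T₀` and every Haar `ν` on `unipDeltaLoc v`, the ROW AT `v`:
  `Gn v s := ν{u | ↑u ∈ K_{H,v}} · [(1 − q_v^{−(2s+1)})(1 − ε_v q_v^{−(2s+2)})∕(1 − q_v^{−2s})] · Σ_{k ≤ m v}(ε_v q_v^{1−2s})^k` (`m v = ord_v τ`, `ε_v = ε_{L∕L⁺}(ϖ_v)`, `q_v = N v`),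
  `hGn` (§1) and **`hW : ∀ s, 1 < re s → ∀ h_v ∈ K_{H,v}, ∫ conj ψ_{S♭}(ι_v y) · Λ_{s,v}((w_Δ)_v·y·h_v) dν(y) = Gn v s`** (★ (4c) `K_v`-invariance ∘ ★ (2d) §2
  `integral_conjChar_lambdaLoc_weylDelta_eq_of_forall` ∘ ★ p863366 §2 `integral_conjChar_single_mul_weylDelta_eq_of_isGoodPlace` ∘ ★ p863366 §1 dictionary; `T₀ = T₁ ∪ T₂ ∪ T₃` as
  ★ p863366 §3).  The bad ∕ CM places of the head set are LH4-p07 (g11)'s `K2LiuKindOneSingularLocalFace` (★ p862868 ∕ ★ p862834 regularity by value).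
HONEST LABEL.  `HC_CM` is proved only modulo the 7 printed citations (2 remaining named inputs: hLiu418 = `stmt-HodgeConjecture-24832`,
h413 = `stmt-HodgeConjecture-24833`) until rung 0 closes.  Count-neutral helper; closes no socket.

## References
* [KudlaSweet1997] S. Kudla, W. J. Sweet, *Degenerate principal series representations for U(n,n)*, Israel J. Math. 98 (1997), §1 (rationality in `q^{−s}`).
* [Tan1999] V. Tan, *Poles of Siegel Eisenstein series on U(n,n)*, Canad. J. Math. 51 (1999), §3, §4 Prop. 4.8.
* [KudlaRallis1994] S. Kudla, S. Rallis, Ann. of Math. 140 (1994), §2.   * [Casselman1980] W. Casselman, Compositio Math. 40 (1980), §3 Thm. 3.1.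
* [HarrisKudlaSweet1996] M. Harris, S. Kudla, W. J. Sweet, J. AMS 9 (1996), §6 (6.14)–(6.16).   * [Tate1950] J. Tate (1950), §2.5, in Cassels–Fröhlich (1967) Ch. XV.
-/

set_option autoImplicit false
set_option linter.dupNamespace false -- the mandated namespace repeats `HodgeConjecture.HodgeConjecture`

noncomputable section

open scoped NNReal ENNReal ComplexConjugate
open Polynomial NumberField IsDedekindDomain Matrix MeasureTheory
open Literature.NumberTheory.GaloisRepresentations.IsNonarchimedeanLocalField
open Literature.NumberTheory.Automorphic Literature.NumberTheory.Automorphic.UnitaryGroup Literature.NumberTheory.GaloisRepresentations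
open Literature.NumberTheory.GelbartRogawski1991 Literature.NumberTheory.GelbartRogawski1991.GRConstruction
open Literature.NumberTheory.GelbartRogawski1991.AdaptedBlocks
open Literature.NumberTheory.GelbartRogawski1991.UnitaryDualPair Literature.NumberTheory.GelbartRogawski1991.UnitaryDualPair.LocalSplitting
open Literature.NumberTheory.K2Lit Literature.NumberTheory.K2Lit.SiegelDoubled Literature.NumberTheory.K2Lit.LocalSiegelDoubled
open Literature.NumberTheory.Automorphic.IdeleClassGroup (IsConjugateSymplectic toHeckeCharacter)
open Summit.HodgeConjecture.HodgeConjecture.Cruxes.HLiu418.K2LiuQRationalDefs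
open Summit.HodgeConjecture.HodgeConjecture.Cruxes.HLiu418.K2LiuQRationalLFactor
open Summit.HodgeConjecture.HodgeConjecture.Cruxes.HLiu418.K2LiuLocalLFactorDefs
open Summit.HodgeConjecture.HodgeConjecture.Cruxes.HLiu418.K2LiuSiegelUnipotentLocalDefs
open Summit.HodgeConjecture.HodgeConjecture.Cruxes.HLiu418.K2LiuSiegelUnipotentFourierDefs
open Summit.HodgeConjecture.HodgeConjecture.Cruxes.HLiu418.K2LiuSiegelUnipotentCharacters
open Summit.HodgeConjecture.HodgeConjecture.Cruxes.HLiu418.K2LiuSphericalSectionLambdaLoc (isSphericalSection_lambdaLoc)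
open Summit.HodgeConjecture.HodgeConjecture.Cruxes.HLiu418.K2LiuRankOneSingularLocalValueCM (integral_conjChar_lambdaLoc_weylDelta_eq_of_forall)
open Summit.HodgeConjecture.HodgeConjecture.Cruxes.HLiu418.K2LiuRankOneSingularLocalValueCMRecord
open Summit.HodgeConjecture.HodgeConjecture.Cruxes.HLiu418.K2LiuSiegelNormaliserTwoOfRecord (splitting_of_record norm_localComponent_of_record)
open Summit.HodgeConjecture.HodgeConjecture.Cruxes.HLiu418.K2LiuSphericalSiegelValueCM (exists_finset_forall_placeLetters_cm exists_finset_forall_record_letters)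
open Summit.HodgeConjecture.HodgeConjecture.Cruxes.HLiu418.K2LiuRankOneCornerCharacterReading (exists_adaptedFrame_eq)

namespace Summit.HodgeConjecture.HodgeConjecture.Cruxes.HLiu418.K2LiuKindOneSingularLocalFaceGoodPlace

/-! ## §1 The `hGn` letter: `C · c^{K1}(s) · Σ_{k≤M} (ε q^{1−2s})^k` is `q^{−s}`-rational and regular on `{0 < re}` -/

section Regularity

/-- the four `q`-powers of the row as Laurent monomials in `X = q^{−s}`: `q^{−2s} = X²`, `q^{−(2s+1)} = q⁻¹X²`, `q^{−(2s+2)} = (q²)⁻¹X²`, `q^{1−2s} = q·X²` (`q ≠ 0`).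
[cite: Casselman1980, §3] -/
theorem cpow_neg_two_mul_eq {q : ℕ} (hq : q ≠ 0) (s : ℂ) :
    (q : ℂ) ^ (-(2 * s)) = qVar q s ^ 2 ∧ (q : ℂ) ^ (-(2 * s + 1)) = (q : ℂ)⁻¹ * qVar q s ^ 2 ∧
      (q : ℂ) ^ (-(2 * s + 2)) = ((q : ℂ) ^ 2)⁻¹ * qVar q s ^ 2 ∧ (q : ℂ) ^ (1 - 2 * s) = (q : ℂ) * qVar q s ^ 2 := by
  have hq0 : (q : ℂ) ≠ 0 := Nat.cast_ne_zero.2 hq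
  have h2 : (q : ℂ) ^ (-(2 * s)) = qVar q s ^ 2 := by
    have h := qVar_natCast_mul (q := q) s 2
    rw [qVar_def, Nat.cast_ofNat] at h
    exact h
  refine ⟨h2, ?_, ?_, ?_⟩
  · rw [show (-(2 * s + 1) : ℂ) = -(2 * s) + (-1 : ℂ) by ring, Complex.cpow_add _ _ hq0, h2, Complex.cpow_neg_one, mul_comm]
  · rw [show (-(2 * s + 2) : ℂ) = -(2 * s) + (-((2 : ℕ) : ℂ)) by push_cast; ring, Complex.cpow_add _ _ hq0, h2, Complex.cpow_neg,
      Complex.cpow_natCast, mul_comm]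
  · rw [show (1 - 2 * s : ℂ) = -(2 * s) + 1 by ring, Complex.cpow_add _ _ hq0, h2, Complex.cpow_one, mul_comm]

/-- **THE `hGn` LETTER OF THE GOOD-PLACE ROW**: for `1 < q`, constants `C ε : ℂ`, `M : ℕ` and `0 < re s₀`, the function
`s ↦ C · [(1 − q^{−(2s+1)})(1 − ε q^{−(2s+2)})∕(1 − q^{−2s})] · Σ_{k≤M}(ε q^{1−2s})^k` is `q^{−s}`-rational and regular at `s₀` — a polynomial in `X = q^{−s}` over `1 − X²`, whose
value at `s₀` is non-zero since `‖q^{−2s₀}‖ < 1` (★ `one_sub_mul_qVar_ne_zero`). [cite: KudlaSweet1997, §1] [cite: Casselman1980, §3] [cite: Tan1999, §4 Prop. 4.8] -/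
theorem isQRationalRegularAt_localScalarK1_mul_twistedPoly {q : ℕ} (hq : 1 < q) (C ε : ℂ) (M : ℕ) {s₀ : ℂ} (hs₀ : 0 < s₀.re) :
    IsQRationalRegularAt q s₀ fun s => C * (((1 - (q : ℂ) ^ (-(2 * s + 1))) * (1 - ε * (q : ℂ) ^ (-(2 * s + 2))) /
            (1 - (q : ℂ) ^ (-(2 * s))) *
            ∑ k ∈ Finset.range (M + 1), (ε * (q : ℂ) ^ (1 - 2 * s)) ^ k)) := by
  have hq0 : q ≠ 0 := by omega
  have hX := fun s => cpow_neg_two_mul_eq hq0 s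
  -- the denominator does not vanish at `s₀`
  have hden : 1 - qVar q s₀ ^ 2 ≠ 0 := by
    rw [← qVar_natCast_mul s₀ 2, Nat.cast_ofNat, ← one_mul (qVar q (2 * s₀))]
    exact one_sub_mul_qVar_ne_zero hq (u := 1) (by rw [norm_one]) (by simp; linarith)
  -- the row in `X = q^{−s}`, letter by letter
  have hA : IsQRationalRegularAt q s₀ fun s => 1 - (q : ℂ)⁻¹ * qVar q s ^ 2 :=
    (isQRationalRegularAt_const q s₀ 1).sub ((isQRationalRegularAt_qVar_pow q s₀ 2).const_mul _)
  have hB : IsQRationalRegularAt q s₀ fun s => 1 - ε * (((q : ℂ) ^ 2)⁻¹ * qVar q s ^ 2) :=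
    (isQRationalRegularAt_const q s₀ 1).sub (((isQRationalRegularAt_qVar_pow q s₀ 2).const_mul _).const_mul ε)
  have hD : IsQRationalRegularAt q s₀ fun s => 1 - qVar q s ^ 2 :=
    (isQRationalRegularAt_const q s₀ 1).sub (isQRationalRegularAt_qVar_pow q s₀ 2)
  have hS : IsQRationalRegularAt q s₀ fun s => ∑ k ∈ Finset.range (M + 1), (ε * ((q : ℂ) * qVar q s ^ 2)) ^ k := by
    refine IsQRationalRegularAt.sum _ fun k _ => ((isQRationalRegularAt_qVar_pow q s₀ (2 * k)).const_mul ((ε * (q : ℂ)) ^ k)).congr fun s => ?_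
    rw [pow_mul]; ring
  have h : IsQRationalRegularAt q s₀ fun s => C * ((1 - (q : ℂ)⁻¹ * qVar q s ^ 2) * (1 - ε * (((q : ℂ) ^ 2)⁻¹ * qVar q s ^ 2)) / (1 - qVar q s ^ 2) *
      ∑ k ∈ Finset.range (M + 1), (ε * ((q : ℂ) * qVar q s ^ 2)) ^ k) :=
    (((hA.mul hB).div hD hden).mul hS).const_mul C
  refine h.congr fun s => ?_
  obtain ⟨h1, h2, h3, h4⟩ := hX s
  rw [h1, h2, h3, h4]

/-- the same letter in the base `residueFieldCard (K_v)` of the finite-place letters ★ p862868 (`= v.residueCard`, ★ `residueFieldCard_adicCompletion_eq`), for the row written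
in `q_v = N v = v.residueCard`. [cite: KudlaSweet1997, §1] [cite: Casselman1980, §3] -/
theorem isQRationalRegularAt_residueFieldCard_localScalarK1_mul_twistedPoly {K : Type} [Field K] [NumberField K] (v : HeightOneSpectrum (𝓞 K)) (C ε : ℂ) (M : ℕ)
    {s₀ : ℂ} (hs₀ : 0 < s₀.re) :
    IsQRationalRegularAt (residueFieldCard (v.adicCompletion K)) s₀ fun s => C * (((1 - (v.residueCard : ℂ) ^ (-(2 * s + 1))) * (1 - ε * (v.residueCard : ℂ) ^ (-(2 * s + 2))) /
            (1 - (v.residueCard : ℂ) ^ (-(2 * s))) *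
            ∑ k ∈ Finset.range (M + 1), (ε * (v.residueCard : ℂ) ^ (1 - 2 * s)) ^ k)) := by
  rw [Literature.NumberTheory.Automorphic.residueFieldCard_adicCompletion_eq K v]
  exact isQRationalRegularAt_localScalarK1_mul_twistedPoly v.one_lt_residueCard C ε M hs₀

end Regularity

/-! ## §2 The good-place row at the record, off one finite set of places -/

section Record

variable (L : Type) [Field L] [NumberField L] [IsCMField L] {N M : ℕ} (e : Fin N × Fin M ≃ Fin 2)
  (dV : Fin N → L) (hdV : ∀ i, IsCMField.complexConj L (dV i) = dV i)
  (dW : Fin M → L) (hdW : ∀ i, IsCMField.complexConj L (dW i) = dW i)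
  [∀ v : HeightOneSpectrum (𝓞 (Fp L)), MeasurableSpace ↥(unipDeltaLoc L e dV hdV dW hdW v)]
  [∀ v : HeightOneSpectrum (𝓞 (Fp L)), BorelSpace ↥(unipDeltaLoc L e dV hdV dW hdW v)]

set_option maxHeartbeats 800000 in -- as ★ (2d) ED. 1 §3 ∕ ★ p863366 §3 (the CM telescope under the cofinite binders)
/-- **THE GOOD-PLACE ROW OF THE K1 PER-PLACE PRODUCER, AT THE RECORD, OFF A FINITE SET OF PLACES.**  Doubled CM datum `H = U(𝕎 ⊕ −𝕎)`, `𝕎 = V ⊗ W` of rank `2` with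
non-degenerate diagonal Gram data (`hdV0`, `hdW0`), `lam : C_L → S¹` conjugate-symplectic, `χ = toHeckeCharacter L lam⁻¹`, corner index `S♭ = single 1 1 σ` with
`τ := t₁ · Tr_{L∕L⁺}(σδ) ≠ 0`.  There is a finite `T₀` such that for every `v ∉ T₀` and EVERY Haar measure `ν` on `N_Δ(L⁺_v) = unipDeltaLoc v` (any normalisation), with
`Gn_v(s) := ν{u | ↑u ∈ K_{H,v}} · [(1 − q_v^{−(2s+1)})(1 − ε(ϖ_v) q_v^{−(2s+2)})∕(1 − q_v^{−2s})] · Σ_{k ∈ range (m v + 1)} (ε(ϖ_v) q_v^{1−2s})^k` (`m v = (−log |ι_v τ|_v).toNat`):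
(`hGn`) `s ↦ Gn_v(s)` is `q_v^{−s}`-rational and regular at every `s₀` with `0 < re s₀` (base `residueFieldCard (L⁺_v)`, as ★ p862868's bad-place letters), and
(`hW`) **`∀ s, 1 < re s → ∀ h_v ∈ K_{H,v}, ∫ y, conj ψ_{S♭}(ι_v y) · Λ_{s,v}((w_Δ)_v · y · h_v) dν(y) = Gn_v(s)`** — the place-letter binders `Gn hGn hW` of ★ p863286 at a good head
place, `W v s h := ∫ conj ψ_{S♭}(ι_v y) · Λ_{s,v}((w_Δ)_v·y·h_v) dν`, `c₀ := 1` (★ (4c) right `K_v`-invariance of `Λ_{s,v}`, ★ (2d) §2 un-normalised head, ★ p863366 §2 + §1).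
[cite: KudlaSweet1997, §1] [cite: Tan1999, §3; §4 Prop. 4.8] [cite: KudlaRallis1994, §2] [cite: Casselman1980, §3 Thm. 3.1] [cite: HarrisKudlaSweet1996, §6 (6.14)–(6.16)] -/
theorem exists_finset_forall_localFace_goodPlace_of_record (hdV0 : ∀ i, dV i ≠ 0) (hdW0 : ∀ i, dW i ≠ 0)
    {lam : IdeleClassGroup L →ₜ* Circle} (hlam : IsConjugateSymplectic L lam) (σ : L) (hτ : gramR L e dV hdV dW hdW 1 1 * Algebra.trace (Fp L) L (σ * imagUnit L) ≠ 0) :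
    ∃ T₀ : Finset (HeightOneSpectrum (𝓞 (Fp L))), ∀ v ∉ T₀,
      ∀ (ν : Measure ↥(unipDeltaLoc L e dV hdV dW hdW v)) [ν.IsHaarMeasure],
        (∀ s₀ : ℂ, 0 < s₀.re → IsQRationalRegularAt (residueFieldCard (v.adicCompletion (Fp L))) s₀ fun s =>
          (ν.real {u : ↥(unipDeltaLoc L e dV hdV dW hdW v) | (u : UnitaryGroup.localPi L (IsCMField.complexConj L) (2 + 2) (hermD L e dV hdV dW hdW) v) ∈ UnitaryGroup.localInt L (IsCMField.complexConj L) (2 + 2) (hermD L e dV hdV dW hdW) v} : ℂ) * (((1 - (v.residueCard : ℂ) ^ (-(2 * s + 1))) * (1 - (quadraticHeckeCharCM L).valueAtUniformizer v * (v.residueCard : ℂ) ^ (-(2 * s + 2))) /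
            (1 - (v.residueCard : ℂ) ^ (-(2 * s))) *
            ∑ k ∈ Finset.range ((-WithZero.log (Valued.v (algebraMap (Fp L) (v.adicCompletion (Fp L)) (gramR L e dV hdV dW hdW 1 1 * Algebra.trace (Fp L) L (σ * imagUnit L))))).toNat + 1), ((quadraticHeckeCharCM L).valueAtUniformizer v * (v.residueCard : ℂ) ^ (1 - 2 * s)) ^ k))) ∧
        ∀ s : ℂ, 1 < s.re → ∀ hv ∈ UnitaryGroup.localInt L (IsCMField.complexConj L) (2 + 2) (hermD L e dV hdV dW hdW) v,
          ∫ y, conj ((unipDeltaChar L e dV hdV dW hdW (Matrix.single 1 1 σ) (locToAdelic L e dV hdV dW hdW v (y : UnitaryGroup.localPi L (IsCMField.complexConj L) (2 + 2) (hermD L e dV hdV dW hdW) v)) : Circle) : ℂ) * LambdaLoc L e dV hdV dW hdW v (toHeckeCharacter L lam⁻¹) s (UnitaryGroup.evalPlace (Fp L) L (IsCMField.complexConj L) (2 + 2) (hermD L e dV hdV dW hdW) v (UnitaryGroup.finPart (Fp L) L (IsCMField.complexConj L) (2 + 2) (hermD L e dV hdV dW hdW) (SiegelDoubled.weylDelta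 L e dV hdV dW hdW)) * (y : UnitaryGroup.localPi L (IsCMField.complexConj L) (2 + 2) (hermD L e dV hdV dW hdW) v) * hv) ∂ν =
            (ν.real {u : ↥(unipDeltaLoc L e dV hdV dW hdW v) | (u : UnitaryGroup.localPi L (IsCMField.complexConj L) (2 + 2) (hermD L e dV hdV dW hdW) v) ∈ UnitaryGroup.localInt L (IsCMField.complexConj L) (2 + 2) (hermD L e dV hdV dW hdW) v} : ℂ) * (((1 - (v.residueCard : ℂ) ^ (-(2 * s + 1))) * (1 - (quadraticHeckeCharCM L).valueAtUniformizer v * (v.residueCard : ℂ) ^ (-(2 * s + 2))) /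
            (1 - (v.residueCard : ℂ) ^ (-(2 * s))) *
            ∑ k ∈ Finset.range ((-WithZero.log (Valued.v (algebraMap (Fp L) (v.adicCompletion (Fp L)) (gramR L e dV hdV dW hdW 1 1 * Algebra.trace (Fp L) L (σ * imagUnit L))))).toNat + 1), ((quadraticHeckeCharCM L).valueAtUniformizer v * (v.residueCard : ℂ) ^ (1 - 2 * s)) ^ k)) := by
  classical
  -- the frame of record with its blocks, the place letters, the record letters, the integrality of `τ` (as ★ p863366 §3)
  obtain ⟨D, Dinv, Q, hDD, hDD', hQm, hQ, -, hDinv⟩ :=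
    exists_adaptedFrame_eq (Fp L) 2 (gramR_isSymm L e dV hdV dW hdW) (isUnit_det_gramR₀ L e dV hdV hdV0 dW hdW hdW0)
  obtain ⟨T₁, hT₁⟩ := exists_finset_forall_placeLetters_cm L e dV hdV dW hdW hdV0 hdW0 (toHeckeCharacter L lam⁻¹) D Dinv
  obtain ⟨T₂, hT₂⟩ := exists_finset_forall_record_letters L (toHeckeCharacter L lam⁻¹)
  obtain ⟨T₃, hT₃⟩ := exists_finset_forall_valued_algebraMap_le_one L hτ
  refine ⟨T₁ ∪ T₂ ∪ T₃, fun v hv ν _ => ⟨fun s₀ hs₀ => isQRationalRegularAt_residueFieldCard_localScalarK1_mul_twistedPoly v _ _ _ hs₀, fun s hs hv' hhv => ?_⟩⟩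
  rw [Finset.mem_union, Finset.mem_union, not_or, not_or] at hv
  obtain ⟨⟨hv₁, hv₂⟩, hv₃⟩ := hv
  obtain ⟨hgood, hDw, hDiw⟩ := hT₁ v hv₁
  obtain ⟨hχT, hχur, hunr⟩ := hT₂ v hv₂
  haveI : Algebra.IsQuadraticExtension (Fp L) L := IsCMField.isQuadraticExtension L
  -- right `K_v`-invariance of the spherical section kills the translate `h_v`
  have hK : ∀ y : ↥(unipDeltaLoc L e dV hdV dW hdW v),
      LambdaLoc L e dV hdV dW hdW v (toHeckeCharacter L lam⁻¹) s (UnitaryGroup.evalPlace (Fp L) L (IsCMField.complexConj L) (2 + 2) (hermD L e dV hdV dW hdW) v (UnitaryGroup.finPart (Fp L) L (IsCMField.complexConj L) (2 + 2) (hermD L e dV hdV dW hdW) (SiegelDoubled.weylDelta L e dV hdV dW hdW)) * (y : UnitaryGroup.localPi L (IsCMField.complexConj L) (2 + 2) (hermD L e dV hdV dW hdW) v) * hv') =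
        LambdaLoc L e dV hdV dW hdW v (toHeckeCharacter L lam⁻¹) s (UnitaryGroup.evalPlace (Fp L) L (IsCMField.complexConj L) (2 + 2) (hermD L e dV hdV dW hdW) v (UnitaryGroup.finPart (Fp L) L (IsCMField.complexConj L) (2 + 2) (hermD L e dV hdV dW hdW) (SiegelDoubled.weylDelta L e dV hdV dW hdW)) * (y : UnitaryGroup.localPi L (IsCMField.complexConj L) (2 + 2) (hermD L e dV hdV dW hdW) v)) := fun y =>
    (isSphericalSection_lambdaLoc L e dV hdV dW hdW v (toHeckeCharacter L lam⁻¹) s hχT).apply_mul_of_mem_localInt hhv _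
  simp_rw [hK]
  -- ★ (2d) §2 (un-normalised head) with `hGK` := ★ p863366 §2, then ★ p863366 §1's dictionary
  have hv1 := integral_conjChar_lambdaLoc_weylDelta_eq_of_forall L e dV hdV dW hdW v ν (Matrix.single 1 1 σ) (toHeckeCharacter L lam⁻¹) hχT s
      (fun vol : ℝ => (vol : ℂ) * ((lF (Fp L) L v (fun w : UnitaryGroup.PlacesOver L v => (toHeckeCharacter L lam⁻¹).localComponent w.1) (2 * s + 1) / lF (Fp L) L v (fun w : UnitaryGroup.PlacesOver L v => (toHeckeCharacter L lam⁻¹).localComponent w.1) (2 * s + 2)) * (lEN (Fp L) L (IsCMField.complexConj L) v (fun w : UnitaryGroup.PlacesOver L v => (toHeckeCharacter L lam⁻¹).localComponent w.1) (2 * s) / lEN (Fp L) L (IsCMField.complexConj L) v (fun w : UnitaryGroup.PlacesOver L v => (toHeckeCharacter L lam⁻¹).localComponent w.1) (2 * s + 1)) *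
          ((lF (Fp L) L v (fun w : UnitaryGroup.PlacesOver L v => (toHeckeCharacter L lam⁻¹).localComponent w.1) (2 * s))⁻¹ *
            ∑ k ∈ Finset.range ((-WithZero.log (Valued.v (algebraMap (Fp L) (v.adicCompletion (Fp L)) (gramR L e dV hdV dW hdW 1 1 * Algebra.trace (Fp L) L (σ * imagUnit L))))).toNat + 1), (unramValue (Fp L) v (chiF (Fp L) L v (fun w : UnitaryGroup.PlacesOver L v => (toHeckeCharacter L lam⁻¹).localComponent w.1)) * (residueFieldCard (v.adicCompletion (Fp L)) : ℂ) ^ (1 - 2 * s)) ^ k)))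
      (fun νN _ f hf => integral_conjChar_single_mul_weylDelta_eq_of_isGoodPlace L e dV hdV dW hdW v D Dinv hDD hDD' Q hQm hQ hDinv hDw hDiw
        (toHeckeCharacter L lam⁻¹) (norm_localComponent_of_record L lam v) hgood σ hτ (hT₃ v hv₃) νN hs hf)
  beta_reduce at hv1
  rw [hv1, K1Value_localComponent_eq_localScalarK1_cm L v (toHeckeCharacter L lam⁻¹) (splitting_of_record L hlam) hχur hunr
    (Classical.arbitrary (UnitaryGroup.PlacesOver L v)) (zero_lt_one.trans hs)]

end Record

end Summit.HodgeConjecture.HodgeConjecture.Cruxes.HLiu418.K2LiuKindOneSingularLocalFaceGoodPlace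

end
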